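import Literature.AnabelianGeometry.EtaleTheta.TemperedFrobenioidOfRankOneObjectR
import Literature.AnabelianGeometry.EtaleTheta.Discharge.Sec3Thm37OfRankOnePointR
import Literature.AnabelianGeometry.EtaleTheta.Discharge.Sec3Cor38iiiTateTowerKummer
import HarnessLib

/-!
# [EtTh] Theorem 3.7 (i)–(iv), monoid type `Λ = ℝ`, at RANK-ONE OBJECTS of any Def. 3.3 (iii) datum (`dm`-generic engine), and at
# the v2 MODEL OF RECORD (Kummer–Tate tower, covering-indexed `Mero`) with NO binder

S. Mochizuki, *The étale theta function and its Frobenioid-theoretic manifestations*, Publ. RIMS **45** (2009), Thm. 3.7, PDF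
pp.79–80; Prop. 3.4 (ii) p.74; Def. 3.6 (ii) p.77 [cite: MochizukiEtTh2009, Thm 3.7 p.79]; [FrdI] Thm. 5.2 p.100, Def. 4.5 (ii) p.86.

abc-iut cell, layer L2, seat abc-iut-L2-d2 (gen 5); item (f) of the v2 chain (memo `VNEXT-V2-RealifiedChain-L2d2.md` §3).  PROOF-ONLY.
CREDIT: §1 is VERBATIM abc-iut-w6-d061's `Sec3Thm37OfRankOnePointR.lean` (p448135) with abc-iut-w6-d048's `ofRankOnePointR hZ P hpf`
replaced by the `dm`-generic `ofRankOneObjectR P hpf` of `TemperedFrobenioidOfRankOneObjectR` (a rank-one OBJECT `P : dm.RankOneObject`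
of abc-iut-w5-d179 over ANY `dm : DivisorMonoids D₀`); the engine is abc-iut-w5-d164's `thm37_ofRlfRWeak_of_inputs_of_cosetCnst`.

* §1 `C`-level binders at `ofRankOneObjectR`: `hBmon`, `hnd` (one-object base), `B` group-like, `Φ` divisorial, **`hrat`** — every
  object STRICTLY RATIONAL (the rational function of `m ∈ Φ₀(Y₀)` is `(ι(div₀ b_m), [ι(m)])`, `b_m` constant from `hcnst`); the END
  KNIT `thm37_ofRankOneObjectR_of_inputs (cnst) (h₀) (hE) (hcyc)` — residual = the three `D₀`-level clauses of Prop. 3.4 (ii).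
* §2 at the v2 MODEL OF RECORD `TateTowerKummer.temperedFrobenioidR` (rank-one object `pt` of `DivisorMonoids.ofTower tower`):
  `TateTowerKummer.prop34Cnst₀_ofTower` (`Prop34Cnst₀` for every CONSTANT constant-field functor: constants take ONE value on a
  transitive `Grp`-set, so their pull-backs along any two covering maps agree — even after the level change `resFn`), and
  **`TateTowerKummer.thm37_temperedFrobenioidR`** — Thm. 3.7 (i)–(iv), `Λ = ℝ`, NO binder: `h₀` here, `hE := effRealSpan_ofTower`
  (p465055), `hcyc := prop34Const_ofTower.hcyc` (p466252).

HONEST LABEL: instantiation / consistency certificates at CONSTRUCTED data (`D` one object; `D^cnst` constant at `𝓑(1)⁰`, where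
clause (iii) has trivial content); refereed pre-IUT material; nothing here bears on [IUTchIII] Cor. 3.12; no side taken; typed ≠ proved —
here proved.
-/

noncomputable section

namespace Literature.AnabelianGeometry.EtaleTheta

open CategoryTheory Opposite Function Literature.AlgebraicGeometry.Frobenioids Literature.AnabelianGeometry.SemiGraphs
  LogDivisorModel LogDivisorModel.GaloisAction

universe u₀ v₀

/-! ## §1 The `Λ = ℝ` engine at rank-one objects -/

namespace TemperedFrobenioid

section RankOneObjectR

variable {D₀ : Type u₀} [Category.{v₀} D₀] {dm : DivisorMonoids.{u₀, v₀, 0} D₀} (P : dm.RankOneObject)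
  (hpf : ∀ Y : D₀ᵒᵖ, IsPerfFactorialCof (dm.Φ₀.obj Y)) (R S : ((Discrete PUnit.{1})ᵒᵖ ⥤ CommMonCat.{0}) → Prop)

/-- `hBmon`: `B` is a monoid on the one-object base. [cite: MochizukiFrdI2008, Thm. 5.2 p.100] -/
theorem isMonoidOn_ratFnFunctor_ofRankOneObjectR : IsMonoidOn (ofRankOneObjectR P hpf R S).ratFnFunctor :=
  Cor38Toy.isMonoidOn_of_punit _

/-- `hnd`: `Φ` is non-dilating (only identity endomorphisms of the base). [cite: MochizukiEtTh2009, Thm 3.7 (ii) p.79] -/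
theorem isNonDilatingOn_ofRankOneObjectR : IsNonDilatingOn (ofRankOneObjectR P hpf R S).divisorMonoid := by
  rw [(ofRankOneObjectR P hpf R S).isNonDilatingOn_divisorMonoid_iff]
  intro X f
  have hf : f = 𝟙 X := Quiver.Hom.unop_inj (Subsingleton.elim _ _)
  subst hf
  have hpull : (ofRankOneObjectR P hpf R S).Φ.pull (𝟙 X) = MonoidHom.id _ := by
    ext x
    rw [SubMonoidOn.coe_pull, CategoryTheory.Functor.map_id, MonoidHom.id_apply]
    rfl
  rw [hpull]
  exact Example39NV.isNonDilating_id

/-- `B` is group-like. [cite: MochizukiFrdI2008, Thm. 5.2 p.100] -/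
theorem isGroupLike_ratFnFunctor_ofRankOneObjectR :
    Objectwise (fun M _ => IsGroupLike M) (ofRankOneObjectR P hpf R S).ratFnFunctor :=
  (ofRankOneObjectR P hpf R S).isGroupLike_ratFnFunctor (RealifiedDivisorMonoids.ofRlfRWeak dm hpf).isUnit_BΛ

/-- `Φ` is objectwise divisorial. [cite: MochizukiFrdI2008, Def. 1.1 p.19] -/
theorem isDivisorial_divisorMonoid_ofRankOneObjectR :
    Objectwise (fun M _ => IsDivisorial M) (ofRankOneObjectR P hpf R S).divisorMonoid :=
  fun _ => PfImageWeak.isDivisorial_mrange_toRealification (hpf (op P.Y₀))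

/-- **`hrat`, strictly: every object of `ofRankOneObjectR` is STRICTLY RATIONAL** w.r.t. THE birationalization and the primary
support (abc-iut-w6-d061's argument: a primary `a₀ ∈ 𝔭` with `a₀^n = ι(m)`, and the rational function `(ι(div₀ b_m), [ι(m)])` of `m`).
[cite: MochizukiFrdI2008, Def. 4.5 (ii) p.86] -/
theorem isStrictlyRational_ofRankOneObjectR (X : (ofRankOneObjectR P hpf R S).category) :
    PreFrobenioidData.IsStrictlyRational
      (PreFrobenioid.biratData
        ((ofRankOneObjectR P hpf R S).isFrobenioid_treeCatVocab_of_isMonoidOn (isMonoidOn_ratFnFunctor_ofRankOneObjectR P hpf R S))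
        (PreFrobenioid.hasBiratSquares_of_isFrobenioid
          ((ofRankOneObjectR P hpf R S).isFrobenioid_treeCatVocab_of_isMonoidOn (isMonoidOn_ratFnFunctor_ofRankOneObjectR P hpf R S))))
      (S := PreFrobenioidData.ofFunctor (ofRankOneObjectR P hpf R S).divisorMonoid (ofRankOneObjectR P hpf R S).toElem)
      (fun a 𝔭 => PrimarySupp a 𝔭) X := by
  classical
  refine (ModelFrobenioid.isStrictlyRational_biratData_iff (isGroupLike_ratFnFunctor_ofRankOneObjectR P hpf R S)
    (isDivisorial_divisorMonoid_ofRankOneObjectR P hpf R S) _ _ _ X).mpr fun 𝔭 => ?_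
  induction 𝔭 using Quotient.inductionOn with
  | h a₀p =>
  obtain ⟨a₀, h₀⟩ := a₀p
  obtain ⟨α, hα⟩ := a₀.2
  obtain ⟨⟨m, n⟩, rfl⟩ := Perfection.mk_surjective α
  dsimp only at hα
  have hα' : (hpf (op P.Y₀)).weak.toRealification (Perfection.of _ m) =
      (hpf (op P.Y₀)).weak.toRealification (Perfection.mk m n) ^ (n : ℕ) := by
    rw [← map_pow, Perfection.mk_pow_self]
  have hpow : a₀ ^ (n : ℕ) =
      (⟨(hpf (op P.Y₀)).weak.toRealification (Perfection.of _ m), ⟨_, rfl⟩⟩ :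
        ↥((ofRankOneObjectR P hpf R S).Φ.carrier (op X.base))) := by
    apply Subtype.ext
    have h1 : Subtype.val (a₀ ^ (n : ℕ)) = (Subtype.val a₀) ^ (n : ℕ) := rfl
    rw [h1]
    show (Subtype.val a₀) ^ (n : ℕ) = (hpf (op P.Y₀)).weak.toRealification (Perfection.of _ m)
    rw [hα']
    exact congrArg (fun t => t ^ (n : ℕ)) hα.symm
  -- the rational function `(ι(div₀ b_m), [ι(m)])` of `m`
  have hrat : ((P.cnstFnR hpf m,
      Algebra.GrothendieckGroup.of (⟨(hpf (op P.Y₀)).weak.toRealification (Perfection.of _ m), ⟨_, rfl⟩⟩ :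
        ↥((ofRankOneObjectR P hpf R S).Φ.carrier (op X.base)))) :
      ((RealifiedDivisorMonoids.ofRlfRWeak dm hpf).BΛ.obj ((ofRankOneObjectR P hpf R S).baseOp (op X.base)) : Type) ×
        Algebra.GrothendieckGroup ((ofRankOneObjectR P hpf R S).Φ.carrier (op X.base))) ∈
      (ofRankOneObjectR P hpf R S).ratFn (op X.base) := by
    change (RealifiedDivisorMonoids.ofRlfRWeak dm hpf).divΛ (op P.Y₀) (P.cnstFnR hpf m) =
      EtaleTheta.gpMap ((ofRankOneObjectR P hpf R S).Φ.carrier (op X.base)).subtype (Algebra.GrothendieckGroup.of _)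
    rw [DivisorMonoids.RankOneObject.divΛ_cnstFnR, EtaleTheta.gpMap_of, EtaleTheta.gpMap_of]
    rfl
  refine ⟨a₀ ^ (n : ℕ), 1, ⟨⟨_, hrat⟩, ?_⟩, ⟨a₀, h₀, rfl, ⟨1, one_pos, by rw [pow_one]; exact dvd_pow_self a₀ n.ne_zero⟩⟩, ?_⟩
  · rw [hpow, map_one, div_one]
    rfl
  · rintro ⟨b₀, hb₀, _, ⟨k, _, ⟨c, hc⟩⟩⟩
    have h1 : b₀ * c = 1 := hc.symm.trans (one_pow k)
    exact hb₀.1 ((PfImageWeak.isDivisorial_mrange_toRealification (hpf (op P.Y₀))).isSharp.1 _ (isUnit_iff_exists_inv.mpr ⟨c, h1⟩))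

/-- **`hrat`: every object of `ofRankOneObjectR` is RATIONAL** ([FrdI] Def. 4.5 (ii)). [cite: MochizukiFrdI2008, Def. 4.5 (ii) p.86] -/
theorem isRational_ofRankOneObjectR (X : (ofRankOneObjectR P hpf R S).category) :
    PreFrobenioidData.IsRational
      (PreFrobenioid.biratData
        ((ofRankOneObjectR P hpf R S).isFrobenioid_treeCatVocab_of_isMonoidOn (isMonoidOn_ratFnFunctor_ofRankOneObjectR P hpf R S))
        (PreFrobenioid.hasBiratSquares_of_isFrobenioid
          ((ofRankOneObjectR P hpf R S).isFrobenioid_treeCatVocab_of_isMonoidOn (isMonoidOn_ratFnFunctor_ofRankOneObjectR P hpf R S))))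
      (S := PreFrobenioidData.ofFunctor (ofRankOneObjectR P hpf R S).divisorMonoid (ofRankOneObjectR P hpf R S).toElem)
      (fun a 𝔭 => PrimarySupp a 𝔭) X :=
  ModelFrobenioid.isRational_of_isStrictlyRational _ _ _ X (isStrictlyRational_ofRankOneObjectR P hpf R S X)

/-- **[EtTh] Theorem 3.7 (i)–(iv), `Λ = ℝ`, at the rank-one-object tempered Frobenioid over ANY Def. 3.3 (iii) datum**, with
`D^cnst = 𝓑(G_K)⁰` for any compact `G_K` and any `cnst`: the `C`-level binders DISCHARGED; residual = `h₀ : Prop34Cnst₀ cnst`, `hE`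
(clause 1 at `Λ = ℝ`), `hcyc` (abc-iut-w6-d061's end knit, `dm`-generic). [cite: MochizukiEtTh2009, Thm 3.7 p.79] -/
theorem thm37_ofRankOneObjectR_of_inputs {GK : Type} [Group GK] [TopologicalSpace GK] [SeparatelyContinuousMul GK] [CompactSpace GK]
    (cnst : D₀ ⥤ CosetCat GK) (h₀ : dm.Prop34Cnst₀ cnst)
    (hE : ∀ (Y : D₀) (b : Algebra.GrothendieckGroup ((RealifiedDivisorMonoids.realDataWeak dm hpf).rlf.obj (op Y)))
      (x : (hpf (op Y)).weak.Rlf),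
      b ∈ ((RealifiedDivisorMonoids.realDataWeak dm hpf).realSpan dm.biratGp).carrier Y → b = Algebra.GrothendieckGroup.of x →
        b ∈ ((RealifiedDivisorMonoids.realDataWeak dm hpf).realSpan dm.cnstGp).carrier Y)
    (hcyc : ∀ Y : D₀ᵒᵖ, ∃ d : dm.Φ₀.obj Y, ∀ b ∈ dm.F₀ Y, ∃ n : ℤ, dm.div₀ Y b = Algebra.GrothendieckGroup.of d ^ n) :
    (PreFrobenioid.IsOfType (PreFrobenioid.IsUnitTrivial (ofRankOneObjectR P hpf R S).toElem) ∧
      PreFrobenioid.IsOfIsotropicType (ofRankOneObjectR P hpf R S).toElem ∧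
      PreFrobenioid.IsOfModelType (ofRankOneObjectR P hpf R S).toElem
        ((ofRankOneObjectR P hpf R S).isFrobenioid_treeCatVocab_of_isMonoidOn (isMonoidOn_ratFnFunctor_ofRankOneObjectR P hpf R S))
        (PreFrobenioid.hasBiratSquares_of_isFrobenioid
          ((ofRankOneObjectR P hpf R S).isFrobenioid_treeCatVocab_of_isMonoidOn (isMonoidOn_ratFnFunctor_ofRankOneObjectR P hpf R S))) ∧
      PreFrobenioidData.IsOfBiratFrobeniusNormalizedType
        (PreFrobenioid.biratData
          ((ofRankOneObjectR P hpf R S).isFrobenioid_treeCatVocab_of_isMonoidOn (isMonoidOn_ratFnFunctor_ofRankOneObjectR P hpf R S))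
          (PreFrobenioid.hasBiratSquares_of_isFrobenioid
            ((ofRankOneObjectR P hpf R S).isFrobenioid_treeCatVocab_of_isMonoidOn
              (isMonoidOn_ratFnFunctor_ofRankOneObjectR P hpf R S)))) ∧
      PreFrobenioid.IsOfType (PreFrobenioid.IsSubQuasiFrobeniusTrivial (ofRankOneObjectR P hpf R S).toElem) ∧
      ¬ PreFrobenioid.IsOfType (PreFrobenioid.IsGroupLikeObj (ofRankOneObjectR P hpf R S).toElem)) ∧
    ((ModelFrobenioid.data (ofRankOneObjectR P hpf R S).divisorMonoid (ofRankOneObjectR P hpf R S).ratFnFunctor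
        (ofRankOneObjectR P hpf R S).divBNatTrans).IsOfStandardType ∧
      (PreFrobenioidData.ofFunctor (ofRankOneObjectR P hpf R S).divisorMonoid
          (ofRankOneObjectR P hpf R S).toElem).IsOfRationallyStandardType
        (PreFrobenioid.rsParams
          ((ofRankOneObjectR P hpf R S).isFrobenioid_treeCatVocab_of_isMonoidOn (isMonoidOn_ratFnFunctor_ofRankOneObjectR P hpf R S))
          fun a 𝔭 => PrimarySupp a 𝔭)) ∧
    (∀ X : (ofRankOneObjectR P hpf R S).category,
      FrobenioidFacade.AutActionFactorsThrough ((ofRankOneObjectR P hpf R S).base ⋙ cnst) (ofRankOneObjectR P hpf R S).toElem X) ∧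
    (ofRankOneObjectR P hpf R S).Thm37_iv :=
  (ofRankOneObjectR P hpf R S).thm37_ofRlfRWeak_of_inputs_of_cosetCnst (cnst := cnst)
    (isMonoidOn_ratFnFunctor_ofRankOneObjectR P hpf R S) PadicFrd.isOfFSMType_discretePUnit.isOfFSMFFType
    (isNonDilatingOn_ofRankOneObjectR P hpf R S) (isRational_ofRankOneObjectR P hpf R S) h₀ hE hcyc

end RankOneObjectR

end TemperedFrobenioid

/-! ## §2 The v2 MODEL OF RECORD: `Prop34Cnst₀` and Theorem 3.7 `Λ = ℝ` with NO binder -/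

namespace TateTowerKummer

open LogDivisorModel.TateTower LogDivisorTower TateTowerFrd

/-- **`Prop34Cnst₀` at the v2 model of record for every CONSTANT constant-field functor**: a constant `b ∈ F₀(Y′)` takes ONE value `ϖ^c`
on the transitive `Grp`-set `Y′`, so its pull-backs along any two covering maps `Y ⟶ Y′` coincide (also after the level change), and
likewise for its log-divisor `c·Σ_j [F_j]`; a constant functor identifies all automorphisms. [cite: MochizukiEtTh2009, Prop 3.4 (ii) p.74] -/
theorem prop34Cnst₀_ofTower {Dc : Type*} [Category Dc] (X₀ : Dc) :
    (DivisorMonoids.ofTower tower).Prop34Cnst₀ ((Functor.const (ConnectedPart (BTemp Grp))).obj X₀) where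
  B₀_map_eq_of_cnst_map_eq {Y Y'} g g' _ b hb := by
    obtain ⟨⟨s₀⟩, htrans⟩ := (BTemp.isConnectedObj_iff Y'.obj).mp Y'.property
    obtain ⟨c, hc⟩ := exists_eq_ofAdd_of_mem_const (hb s₀)
    have hall := apply_eq_of_apply_eq_const_action act (gset Y') (fun k => Multiplicative.toAdd k.1) act_actFn_apply htrans s₀ b hc
    refine Subtype.ext (funext fun s => ?_)
    change tower.resFn _ (b.1 (g.hom.hom.hom s)) = tower.resFn _ (b.1 (g'.hom.hom.hom s))
    rw [hall, hall]
  Φ₀_map_eq_of_cnst_map_eq {Y Y'} g g' _ x hx := by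
    obtain ⟨b, hb, hbx⟩ := hx
    obtain ⟨⟨s₀⟩, htrans⟩ := (BTemp.isConnectedObj_iff Y'.obj).mp Y'.property
    obtain ⟨c, hc⟩ := exists_eq_ofAdd_of_mem_const (hb s₀)
    have hall := apply_eq_of_apply_eq_const_action act (gset Y') (fun k => Multiplicative.toAdd k.1) act_actFn_apply htrans s₀ b hc
    have hdiv : ∀ s, x.1 s = (constDIV c : TateTower.model.DIV) := fun s => by
      have h := (act.divZeroHom_eq_div_iff (gset Y') b x 1).1 (by rw [map_one, div_one]; exact hbx) s
      rw [← h, divAt_eq_constDIV_action act (gset Y') b s c (hall s)]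
      exact mul_one _
    refine Subtype.ext (funext fun s => ?_)
    change tower.resDIV _ (x.1 (g.hom.hom.hom s)) = tower.resDIV _ (x.1 (g'.hom.hom.hom s))
    rw [hdiv, hdiv]
  cnst_map_eq_of_B₀_map_eq _ _ _ := rfl

variable (R S : ((Discrete PUnit.{1})ᵒᵖ ⥤ CommMonCat.{0}) → Prop)

/-- **[EtTh] Theorem 3.7 (i)–(iv), monoid type `Λ = ℝ`, at the v2 MODEL OF RECORD with NO binder** (`D^cnst` the constant functor at
`𝓑(1)⁰`): `thm37_ofRankOneObjectR_of_inputs` with `h₀ := prop34Cnst₀_ofTower`, `hE := effRealSpan_ofTower` (p465055), `hcyc :=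
prop34Const_ofTower.hcyc` (p466252). [cite: MochizukiEtTh2009, Thm 3.7 p.79] -/
theorem thm37_temperedFrobenioidR :
    (PreFrobenioid.IsOfType (PreFrobenioid.IsUnitTrivial (TateTowerKummer.temperedFrobenioidR R S).toElem) ∧
      PreFrobenioid.IsOfIsotropicType (TateTowerKummer.temperedFrobenioidR R S).toElem ∧
      PreFrobenioid.IsOfModelType (TateTowerKummer.temperedFrobenioidR R S).toElem
        ((TateTowerKummer.temperedFrobenioidR R S).isFrobenioid_treeCatVocab_of_isMonoidOn
          (TemperedFrobenioid.isMonoidOn_ratFnFunctor_ofRankOneObjectR rankOneObject hpf R S))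
        (PreFrobenioid.hasBiratSquares_of_isFrobenioid
          ((TateTowerKummer.temperedFrobenioidR R S).isFrobenioid_treeCatVocab_of_isMonoidOn
            (TemperedFrobenioid.isMonoidOn_ratFnFunctor_ofRankOneObjectR rankOneObject hpf R S))) ∧
      PreFrobenioidData.IsOfBiratFrobeniusNormalizedType
        (PreFrobenioid.biratData
          ((TateTowerKummer.temperedFrobenioidR R S).isFrobenioid_treeCatVocab_of_isMonoidOn
            (TemperedFrobenioid.isMonoidOn_ratFnFunctor_ofRankOneObjectR rankOneObject hpf R S))
          (PreFrobenioid.hasBiratSquares_of_isFrobenioid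
            ((TateTowerKummer.temperedFrobenioidR R S).isFrobenioid_treeCatVocab_of_isMonoidOn
              (TemperedFrobenioid.isMonoidOn_ratFnFunctor_ofRankOneObjectR rankOneObject hpf R S)))) ∧
      PreFrobenioid.IsOfType (PreFrobenioid.IsSubQuasiFrobeniusTrivial (TateTowerKummer.temperedFrobenioidR R S).toElem) ∧
      ¬ PreFrobenioid.IsOfType (PreFrobenioid.IsGroupLikeObj (TateTowerKummer.temperedFrobenioidR R S).toElem)) ∧
    ((ModelFrobenioid.data (TateTowerKummer.temperedFrobenioidR R S).divisorMonoid (TateTowerKummer.temperedFrobenioidR R S).ratFnFunctor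
        (TateTowerKummer.temperedFrobenioidR R S).divBNatTrans).IsOfStandardType ∧
      (PreFrobenioidData.ofFunctor (TateTowerKummer.temperedFrobenioidR R S).divisorMonoid
          (TateTowerKummer.temperedFrobenioidR R S).toElem).IsOfRationallyStandardType
        (PreFrobenioid.rsParams
          ((TateTowerKummer.temperedFrobenioidR R S).isFrobenioid_treeCatVocab_of_isMonoidOn
            (TemperedFrobenioid.isMonoidOn_ratFnFunctor_ofRankOneObjectR rankOneObject hpf R S))
          fun a 𝔭 => PrimarySupp a 𝔭)) ∧
    (∀ X : (TateTowerKummer.temperedFrobenioidR R S).category,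
      FrobenioidFacade.AutActionFactorsThrough
        ((TateTowerKummer.temperedFrobenioidR R S).base ⋙
          (Functor.const (ConnectedPart (BTemp Grp))).obj
            (Literature.AnabelianGeometry.SemiGraphs.CosetCat.top : Literature.AnabelianGeometry.SemiGraphs.CosetCat PUnit.{1}))
        (TateTowerKummer.temperedFrobenioidR R S).toElem X) ∧
    (TateTowerKummer.temperedFrobenioidR R S).Thm37_iv :=
  TemperedFrobenioid.thm37_ofRankOneObjectR_of_inputs rankOneObject hpf R S
    ((Functor.const (ConnectedPart (BTemp Grp))).obj
      (Literature.AnabelianGeometry.SemiGraphs.CosetCat.top : Literature.AnabelianGeometry.SemiGraphs.CosetCat PUnit.{1}))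
    (prop34Cnst₀_ofTower _) effRealSpan_ofTower prop34Const_ofTower.hcyc

end TateTowerKummer

end Literature.AnabelianGeometry.EtaleTheta

end
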